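import Mathlib
import HarnessLib
import Summits.ResolutionOfSingularities.ResolutionOfSingularities.Theorems.WildQuotientsWildQuotientResolutionJordanFourChartSeams
import Summits.ResolutionOfSingularities.ResolutionOfSingularities.Theorems.WildQuotientsWildQuotientResolutionJordanFourChartWRing

/-!
# V4U ring brick `H₁` (the `μ₂` piece on `chartW`) — scheme side over the `chartW` seam
(crux stmt-ResolutionOfSingularities-15640 `WildQuotients.WildQuotientResolution`, line `Sketch`;
chain w45c programme V4U, `L/w45c/CHAIN.md` v7.8 §0 «REMAINING: H₁», res-L1-w45c-plan-1
RULING 08:52Z (ring side / scheme side split) and RULING 09:28Z «stub-5: GO NOW on `brickH1W`»;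
written by res-D-pv-033 AS res-L1-w45c-stub-5. [OURS · L1 W4.5c] — assembly of landed decls,
NOT a statement of any manuscript; replaces the role of no printed item.)

`JordanFour.brickH1W` is the hypothesis `H₁` of res-L1-w45c-lead-1's
`JordanFour.jordanFour_hasResolution_of_ringBricks` (p512651) VERBATIM: for the `J₄` datum `σ`
(`x_b ↦ x_b + x_a`, `x_c ↦ x_c + x_b`, `x_d ↦ x_d + x_c`, characteristic `p ≥ 5`), every lifted
action `ρB` on `Bl_{I₆} 𝔸ⁿ → 𝔸ⁿ → 𝔸ⁿ/⟨σ⟩`, every stable affine open `O₁` equal to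
`chartW = D₊(T′t · H′³t²)` and all chart ratios `T_j` (`j ≠ 4`) on `V[T′]`, there are `R₁`, a radical
ideal `J₁` with `Bl_{J₁}` regular, and an injective `ψ : R₁ → Γ(O₁)` with `range ψ = Γ(O₁)^{⟨σ⟩}` and
`√(ψ⁻¹⟨π^*x_a, π^*x_b, π^*x_c, T_j⟩) = J₁`.

Assembly (no mathematics of its own): res-L1-w45c-stub-1's RING SIDE
`JordanFour.exists_ringBrick_T_chartW` (p517131) — the same conclusion inside the homogeneous
localisation `B_W = (k[x][I₆t])_{(T′t·H′³t²)}` for ANY graded family `φ` with the coefficient law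
and ANY ratios `t_j ∈ B_W` — read through res-L1-w45c-stub-5's seam
`JordanFour.exists_sectionsEquiv_chartW` (p514168): `Ω : B_W ≃+* Γ(↥O₁, (O₁.ι ≫ π ≫ q)⁻¹ ⊤)` with
(o) the coefficient law, (i') `(π^* f)|_{O₁} = Ω (f/1)`, (iii) `Ω y ∈ invariantsRing ⊤ ↔ ∀ g, φ_g y = y`.
The transport is the abstract `JordanFour.ringBrick_transport` (small types only: `ψ := Ω ∘ ψC`,
`t_j := Ω⁻¹ (T_j|_{O₁})`, the range by (iii), the radical identity by `Ideal.map_symm`/`Ideal.map_span`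
on the two image sets), and `brickH1W` is ONE `exact` on the literal statement.

Consumer term (for `JordanFour.jordanFour_hasResolution` = p512651 applied to the bricks):
`brickH1W p hp hp5 k n σ a b c d hab hac had hbc hbd hcd hb hc hd hσ` (then the `H₁` binders).
-/

-- single-problem summit: the doubled namespace component `ResolutionOfSingularities` is forced
set_option linter.dupNamespace false

noncomputable section

open CategoryTheory AlgebraicGeometry TopologicalSpace MvPolynomial Polynomial HomogeneousLocalization
open Literature.AlgebraicGeometry.Resolution Literature.AlgebraicGeometry.RelativeSpec

namespace Summit.ResolutionOfSingularities.ResolutionOfSingularities.Theorems.WildQuotientResolution.JordanFour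

/-! ## The abstract transport along a sections isomorphism -/

/-- **Transport of a ring brick along a sections isomorphism `Ω : B_W ≃+* C`.** Small types only:
`ι0 : S → Γ₀` and `πapp : Γ₀ → Γ₁` stand for `ι₀` and `π^*|_V`, `r : Γ₁ →+* C` for the restriction
to `O₁`, `base : S → B_W` for `f ↦ f/1`, `Inv` for the invariants, `P` for «fixed by every `φ_g`».
Given the ring-side brick `H` for all ratios `t` with `base tP · t_j = base (gen j)`, the scheme-side
brick follows with `ψ := Ω ∘ ψC` and `t_j := Ω⁻¹ (r (T j))`. [folklore; bookkeeping] -/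
theorem ringBrick_transport {S Γ₀ Γ₁ BW C : Type} [CommRing Γ₁] [CommRing BW] [CommRing C]
    {ι : Type} (ι0 : S → Γ₀) (πapp : Γ₀ → Γ₁) (r : Γ₁ →+* C) (base : S → BW) (Ω : BW ≃+* C)
    (hbase : ∀ f, r (πapp (ι0 f)) = Ω (base f))
    (Inv : Subring C) (P : BW → Prop) (hinv : ∀ y, Ω y ∈ Inv ↔ P y)
    (tP : S) (gen : ι → S) (F : Set S) (T : ι → Γ₁)
    (hT : ∀ j, πapp (ι0 (gen j)) = πapp (ι0 tP) * T j)
    (H : ∀ t : ι → BW, (∀ j, base tP * t j = base (gen j)) →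
      ∃ (R₀ : Type) (_ : CommRing R₀) (J₀ : Ideal R₀) (ψC : R₀ →+* BW), Function.Injective ψC ∧
        (∀ y : BW, y ∈ Set.range ψC ↔ P y) ∧ J₀.IsRadical ∧ Scheme.IsRegular (affineBlowup J₀) ∧
        ((Ideal.span (base '' F ∪ Set.range t)).comap ψC).radical = J₀) :
    ∃ (R₀ : Type) (_ : CommRing R₀) (J₀ : Ideal R₀) (ψ : R₀ →+* C), Function.Injective ψ ∧
      ψ.range = Inv ∧ J₀.IsRadical ∧ Scheme.IsRegular (affineBlowup J₀) ∧
      ((Ideal.span (r '' (πapp '' (ι0 '' F) ∪ Set.range T))).comap ψ).radical = J₀ := by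
  -- the base elements and the ratios read in `B_W`
  have hfun : ∀ f, Ω.symm (r (πapp (ι0 f))) = base f := fun f => by
    rw [hbase, RingEquiv.symm_apply_apply]
  have ht : ∀ j, base tP * Ω.symm (r (T j)) = base (gen j) := by
    intro j
    apply Ω.injective
    rw [map_mul, RingEquiv.apply_symm_apply, ← hbase, ← hbase, hT, map_mul]
  obtain ⟨R₀, _, J₀, ψC, hinj, hrange, hrad, hreg, hJ⟩ := H (fun j => Ω.symm (r (T j))) ht
  refine ⟨R₀, inferInstance, J₀, Ω.toRingHom.comp ψC, Ω.injective.comp hinj, ?_, hrad, hreg, ?_⟩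
  · -- range = invariants, by (iii)
    ext y
    rw [RingHom.mem_range]
    constructor
    · rintro ⟨x, rfl⟩
      rw [RingHom.comp_apply, RingEquiv.toRingHom_eq_coe, RingHom.coe_coe]
      exact (hinv (ψC x)).2 ((hrange (ψC x)).1 ⟨x, rfl⟩)
    · intro hy
      have hy' : P (Ω.symm y) := (hinv (Ω.symm y)).1 (by rwa [RingEquiv.apply_symm_apply])
      obtain ⟨x, hx⟩ := (hrange (Ω.symm y)).2 hy'
      refine ⟨x, ?_⟩
      rw [RingHom.comp_apply, RingEquiv.toRingHom_eq_coe, RingHom.coe_coe, hx,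
        RingEquiv.apply_symm_apply]
  · -- the radical identity: pull the generating set back along `Ω`
    have hset : Ω.symm '' (r '' (πapp '' (ι0 '' F) ∪ Set.range T)) =
        base '' F ∪ Set.range (fun j => Ω.symm (r (T j))) := by
      simp only [Set.image_union, Set.image_image, ← Set.range_comp, Function.comp_def, hfun]
    rw [← Ideal.comap_comap, RingEquiv.toRingHom_eq_coe, Ideal.comap_coe, ← Ideal.map_symm,
      Ideal.map_span, hset]
    exact hJ

/-! ## The brick `H₁` -/

-- the statement is the literal `H₁` binder of p512651 (large chart / quotient terms): head-room
set_option maxHeartbeats 8000000 in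
/-- **The `μ₂` ring brick `H₁` of the J₄ toric exit on `chartW`** = hypothesis `H₁` of
`JordanFour.jordanFour_hasResolution_of_ringBricks` (p512651) verbatim; see the module docstring.
[OURS · L1 W4.5c] [folklore; assembly of landed decls: p517131 ring side ∘ p514168 seam] -/
theorem brickH1W (p : ℕ) (hp : p.Prime) (hp5 : 5 ≤ p)
    (k : Type) [Field k] [CharP k p] (n : ℕ)
    (σ : MvPolynomial (Fin n) k ≃ₐ[k] MvPolynomial (Fin n) k) [Finite ↥(Subgroup.zpowers σ)]
    (a b c d : Fin n) (hab : a ≠ b) (hac : a ≠ c) (had : a ≠ d) (hbc : b ≠ c) (hbd : b ≠ d)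
    (hcd : c ≠ d)
    (hb : σ (X b) = X b + X a) (hc : σ (X c) = X c + X b) (hd : σ (X d) = X d + X c)
    (hσ : ∀ i, i ≠ b → i ≠ c → i ≠ d → σ (X i) = X i)
    (ρ : ↥(Subgroup.zpowers σ) →* Aut (Spec (CommRingCat.of (MvPolynomial (Fin n) k))))
      (hρ : ∀ g : ↥(Subgroup.zpowers σ), (ρ g).hom = Spec.map (CommRingCat.ofHom
        ((MulSemiringAction.toRingEquiv (↥(Subgroup.zpowers σ)) (MvPolynomial (Fin n) k) g⁻¹ :
          MvPolynomial (Fin n) k ≃+* MvPolynomial (Fin n) k) :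
            MvPolynomial (Fin n) k →+* MvPolynomial (Fin n) k)))
      (ρB : ActionOver
        (affineBlowup.π (Ideal.span (Set.range (![X a ^ 2, X a * X b ^ 2, X a * X b * X c, X a * X c ^ 3, X b ^ 3, X b ^ 2 * X c ^ 2, X b * X c ^ 4, X c ^ 6] : Fin 8 → MvPolynomial (Fin n) k))) ≫
          Spec.map (CommRingCat.ofHom (algebraMap
            (FixedPoints.subalgebra k (MvPolynomial (Fin n) k) (Subgroup.zpowers σ))
            (MvPolynomial (Fin n) k))))
        ↥(Subgroup.zpowers σ))
      (hρB : ρB.aut = (affineBlowup.isBlowup (Ideal.span (Set.range (![X a ^ 2, X a * X b ^ 2, X a * X b * X c, X a * X c ^ 3, X b ^ 3, X b ^ 2 * X c ^ 2, X b * X c ^ 4, X c ^ 6] : Fin 8 → MvPolynomial (Fin n) k)))).liftAction ρ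
          (idealSheaf_I6_comap k n σ a b c (hσ a hab hac had) hb hc ρ hρ))
      (O₁ : ρB.StableAffineOpens) (hO₁ : O₁.1 = chartW k n a b c d)
      (hle : ((O₁.1.ι ≫ affineBlowup.π (Ideal.span (Set.range (![X a ^ 2, X a * X b ^ 2, X a * X b * X c, X a * X c ^ 3, X b ^ 3, X b ^ 2 * X c ^ 2, X b * X c ^ 4, X c ^ 6] : Fin 8 → MvPolynomial (Fin n) k))) ≫
          Spec.map (CommRingCat.ofHom (algebraMap
            (FixedPoints.subalgebra k (MvPolynomial (Fin n) k) (Subgroup.zpowers σ))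
            (MvPolynomial (Fin n) k)))) ⁻¹ᵁ ⊤ : (O₁.1 : Scheme.{0}).Opens) ≤
        O₁.1.ι ⁻¹ᵁ blowupChart
          (affineBlowup.π (Ideal.span (Set.range (![X a ^ 2, X a * X b ^ 2, X a * X b * X c, X a * X c ^ 3, X b ^ 3, X b ^ 2 * X c ^ 2, X b * X c ^ 4, X c ^ 6] : Fin 8 → MvPolynomial (Fin n) k))))
          (affineBlowup.idealSheaf (Ideal.span (Set.range (![X a ^ 2, X a * X b ^ 2, X a * X b * X c, X a * X c ^ 3, X b ^ 3, X b ^ 2 * X c ^ 2, X b * X c ^ 4, X c ^ 6] : Fin 8 → MvPolynomial (Fin n) k))))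
          ⟨⊤, isAffineOpen_top _⟩
          ((Scheme.ΓSpecIso (CommRingCat.of (MvPolynomial (Fin n) k))).inv.hom (tPrime k n a b c d)))
      (T : {j : Fin 8 // j ≠ 4} → Γ(affineBlowup (Ideal.span (Set.range (![X a ^ 2, X a * X b ^ 2, X a * X b * X c, X a * X c ^ 3, X b ^ 3, X b ^ 2 * X c ^ 2, X b * X c ^ 4, X c ^ 6] : Fin 8 → MvPolynomial (Fin n) k))),
        blowupChart
          (affineBlowup.π (Ideal.span (Set.range (![X a ^ 2, X a * X b ^ 2, X a * X b * X c, X a * X c ^ 3, X b ^ 3, X b ^ 2 * X c ^ 2, X b * X c ^ 4, X c ^ 6] : Fin 8 → MvPolynomial (Fin n) k))))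
          (affineBlowup.idealSheaf (Ideal.span (Set.range (![X a ^ 2, X a * X b ^ 2, X a * X b * X c, X a * X c ^ 3, X b ^ 3, X b ^ 2 * X c ^ 2, X b * X c ^ 4, X c ^ 6] : Fin 8 → MvPolynomial (Fin n) k))))
          ⟨⊤, isAffineOpen_top _⟩
          ((Scheme.ΓSpecIso (CommRingCat.of (MvPolynomial (Fin n) k))).inv.hom (tPrime k n a b c d))))
      (hT : ∀ j, (affineBlowup.π (Ideal.span (Set.range (![X a ^ 2, X a * X b ^ 2, X a * X b * X c, X a * X c ^ 3, X b ^ 3, X b ^ 2 * X c ^ 2, X b * X c ^ 4, X c ^ 6] : Fin 8 → MvPolynomial (Fin n) k)))).appLE ⊤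
            (blowupChart
              (affineBlowup.π (Ideal.span (Set.range (![X a ^ 2, X a * X b ^ 2, X a * X b * X c, X a * X c ^ 3, X b ^ 3, X b ^ 2 * X c ^ 2, X b * X c ^ 4, X c ^ 6] : Fin 8 → MvPolynomial (Fin n) k))))
              (affineBlowup.idealSheaf (Ideal.span (Set.range (![X a ^ 2, X a * X b ^ 2, X a * X b * X c, X a * X c ^ 3, X b ^ 3, X b ^ 2 * X c ^ 2, X b * X c ^ 4, X c ^ 6] : Fin 8 → MvPolynomial (Fin n) k))))
              ⟨⊤, isAffineOpen_top _⟩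
              ((Scheme.ΓSpecIso (CommRingCat.of (MvPolynomial (Fin n) k))).inv.hom (tPrime k n a b c d)))
            (blowupChart_le_preimage (affineBlowup.π (Ideal.span (Set.range (![X a ^ 2, X a * X b ^ 2, X a * X b * X c, X a * X c ^ 3, X b ^ 3, X b ^ 2 * X c ^ 2, X b * X c ^ 4, X c ^ 6] : Fin 8 → MvPolynomial (Fin n) k)))) (affineBlowup.idealSheaf (Ideal.span (Set.range (![X a ^ 2, X a * X b ^ 2, X a * X b * X c, X a * X c ^ 3, X b ^ 3, X b ^ 2 * X c ^ 2, X b * X c ^ 4, X c ^ 6] : Fin 8 → MvPolynomial (Fin n) k)))) ⟨⊤, isAffineOpen_top _⟩ ((Scheme.ΓSpecIso (CommRingCat.of (MvPolynomial (Fin n) k))).inv.hom (tPrime k n a b c d)))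
            ((Scheme.ΓSpecIso (CommRingCat.of (MvPolynomial (Fin n) k))).inv.hom
              ((![X a ^ 2, X a * X b ^ 2, X a * X b * X c, X a * X c ^ 3, X b ^ 3, X b ^ 2 * X c ^ 2, X b * X c ^ 4, X c ^ 6] : Fin 8 → MvPolynomial (Fin n) k) j.1)) =
          (affineBlowup.π (Ideal.span (Set.range (![X a ^ 2, X a * X b ^ 2, X a * X b * X c, X a * X c ^ 3, X b ^ 3, X b ^ 2 * X c ^ 2, X b * X c ^ 4, X c ^ 6] : Fin 8 → MvPolynomial (Fin n) k)))).appLE ⊤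
            (blowupChart
              (affineBlowup.π (Ideal.span (Set.range (![X a ^ 2, X a * X b ^ 2, X a * X b * X c, X a * X c ^ 3, X b ^ 3, X b ^ 2 * X c ^ 2, X b * X c ^ 4, X c ^ 6] : Fin 8 → MvPolynomial (Fin n) k))))
              (affineBlowup.idealSheaf (Ideal.span (Set.range (![X a ^ 2, X a * X b ^ 2, X a * X b * X c, X a * X c ^ 3, X b ^ 3, X b ^ 2 * X c ^ 2, X b * X c ^ 4, X c ^ 6] : Fin 8 → MvPolynomial (Fin n) k))))
              ⟨⊤, isAffineOpen_top _⟩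
              ((Scheme.ΓSpecIso (CommRingCat.of (MvPolynomial (Fin n) k))).inv.hom (tPrime k n a b c d)))
            (blowupChart_le_preimage (affineBlowup.π (Ideal.span (Set.range (![X a ^ 2, X a * X b ^ 2, X a * X b * X c, X a * X c ^ 3, X b ^ 3, X b ^ 2 * X c ^ 2, X b * X c ^ 4, X c ^ 6] : Fin 8 → MvPolynomial (Fin n) k)))) (affineBlowup.idealSheaf (Ideal.span (Set.range (![X a ^ 2, X a * X b ^ 2, X a * X b * X c, X a * X c ^ 3, X b ^ 3, X b ^ 2 * X c ^ 2, X b * X c ^ 4, X c ^ 6] : Fin 8 → MvPolynomial (Fin n) k)))) ⟨⊤, isAffineOpen_top _⟩ ((Scheme.ΓSpecIso (CommRingCat.of (MvPolynomial (Fin n) k))).inv.hom (tPrime k n a b c d)))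
            ((Scheme.ΓSpecIso (CommRingCat.of (MvPolynomial (Fin n) k))).inv.hom (tPrime k n a b c d)) *
              T j) :
      ∃ (R₁ : Type) (_ : CommRing R₁) (J₁ : Ideal R₁)
        (ψ : R₁ →+* Γ((O₁.1 : Scheme.{0}), (O₁.1.ι ≫ affineBlowup.π (Ideal.span (Set.range (![X a ^ 2, X a * X b ^ 2, X a * X b * X c, X a * X c ^ 3, X b ^ 3, X b ^ 2 * X c ^ 2, X b * X c ^ 4, X c ^ 6] : Fin 8 → MvPolynomial (Fin n) k))) ≫
          Spec.map (CommRingCat.ofHom (algebraMap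
            (FixedPoints.subalgebra k (MvPolynomial (Fin n) k) (Subgroup.zpowers σ))
            (MvPolynomial (Fin n) k)))) ⁻¹ᵁ ⊤)),
        Function.Injective ψ ∧ ψ.range = (ρB.restrict O₁.1 O₁.2.1).invariantsRing ⊤ ∧
        J₁.IsRadical ∧ Scheme.IsRegular (affineBlowup J₁) ∧
        ((Ideal.span ((O₁.1.ι.appLE
            (blowupChart
              (affineBlowup.π (Ideal.span (Set.range (![X a ^ 2, X a * X b ^ 2, X a * X b * X c, X a * X c ^ 3, X b ^ 3, X b ^ 2 * X c ^ 2, X b * X c ^ 4, X c ^ 6] : Fin 8 → MvPolynomial (Fin n) k))))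
              (affineBlowup.idealSheaf (Ideal.span (Set.range (![X a ^ 2, X a * X b ^ 2, X a * X b * X c, X a * X c ^ 3, X b ^ 3, X b ^ 2 * X c ^ 2, X b * X c ^ 4, X c ^ 6] : Fin 8 → MvPolynomial (Fin n) k))))
              ⟨⊤, isAffineOpen_top _⟩
              ((Scheme.ΓSpecIso (CommRingCat.of (MvPolynomial (Fin n) k))).inv.hom (tPrime k n a b c d)))
            ((O₁.1.ι ≫ affineBlowup.π (Ideal.span (Set.range (![X a ^ 2, X a * X b ^ 2, X a * X b * X c, X a * X c ^ 3, X b ^ 3, X b ^ 2 * X c ^ 2, X b * X c ^ 4, X c ^ 6] : Fin 8 → MvPolynomial (Fin n) k))) ≫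
              Spec.map (CommRingCat.ofHom (algebraMap
                (FixedPoints.subalgebra k (MvPolynomial (Fin n) k) (Subgroup.zpowers σ))
                (MvPolynomial (Fin n) k)))) ⁻¹ᵁ ⊤) hle) ''
          (((affineBlowup.π (Ideal.span (Set.range (![X a ^ 2, X a * X b ^ 2, X a * X b * X c, X a * X c ^ 3, X b ^ 3, X b ^ 2 * X c ^ 2, X b * X c ^ 4, X c ^ 6] : Fin 8 → MvPolynomial (Fin n) k)))).appLE ⊤
              (blowupChart
                (affineBlowup.π (Ideal.span (Set.range (![X a ^ 2, X a * X b ^ 2, X a * X b * X c, X a * X c ^ 3, X b ^ 3, X b ^ 2 * X c ^ 2, X b * X c ^ 4, X c ^ 6] : Fin 8 → MvPolynomial (Fin n) k))))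
                (affineBlowup.idealSheaf (Ideal.span (Set.range (![X a ^ 2, X a * X b ^ 2, X a * X b * X c, X a * X c ^ 3, X b ^ 3, X b ^ 2 * X c ^ 2, X b * X c ^ 4, X c ^ 6] : Fin 8 → MvPolynomial (Fin n) k))))
                ⟨⊤, isAffineOpen_top _⟩
                ((Scheme.ΓSpecIso (CommRingCat.of (MvPolynomial (Fin n) k))).inv.hom (tPrime k n a b c d)))
              (blowupChart_le_preimage (affineBlowup.π (Ideal.span (Set.range (![X a ^ 2, X a * X b ^ 2, X a * X b * X c, X a * X c ^ 3, X b ^ 3, X b ^ 2 * X c ^ 2, X b * X c ^ 4, X c ^ 6] : Fin 8 → MvPolynomial (Fin n) k)))) (affineBlowup.idealSheaf (Ideal.span (Set.range (![X a ^ 2, X a * X b ^ 2, X a * X b * X c, X a * X c ^ 3, X b ^ 3, X b ^ 2 * X c ^ 2, X b * X c ^ 4, X c ^ 6] : Fin 8 → MvPolynomial (Fin n) k)))) ⟨⊤, isAffineOpen_top _⟩ ((Scheme.ΓSpecIso (CommRingCat.of (MvPolynomial (Fin n) k))).inv.hom (tPrime k n a b c d)))) ''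
            ((Scheme.ΓSpecIso (CommRingCat.of (MvPolynomial (Fin n) k))).inv '' {X a, X b, X c}) ∪
            Set.range T))).comap ψ).radical = J₁ := by
  have Hseam := exists_sectionsEquiv_chartW k n σ a b c d hab hac had hb hc hd hσ ρ hρ ρB hρB O₁ hO₁ hle
  rcases Hseam with ⟨φ, hP, Ω, hφ, hbase, -, hinv⟩
  exact ringBrick_transport _ _ _ _ Ω hbase _ _ hinv (tPrime k n a b c d) _
    ({X a, X b, X c} : Set (MvPolynomial (Fin n) k)) T hT
    (fun t ht => exists_ringBrick_T_chartW k n a b c d p hp hp5 σ hab hac had hbc hbd hcd hb hc hd hσ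
      φ hφ hP t ht)

end Summit.ResolutionOfSingularities.ResolutionOfSingularities.Theorems.WildQuotientResolution.JordanFour

end
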